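import Literature.AlgebraicGeometry.ShimuraVarieties.UnitaryShimuraComplexRecord
import Literature.AlgebraicGeometry.ShimuraVarieties.UnitaryShimuraHeckeComplex
import Literature.AlgebraicGeometry.Motives.AlgPointsSeparate
import Literature.AlgebraicGeometry.Motives.VarietiesGeometricallyIntegralProofs
import HarnessLib

/-!
# The complex record SYSTEM of `Sh(U(H), 𝔹²)` below a small level: Hecke translates of complex records and the
# projective system assembled from one complex record per level

Topic `AlgebraicGeometry/ShimuraVarieties`; namespace `Literature.AlgebraicGeometry.ShimuraVarieties`, grouping sub-namespace
`UnitaryCanonicalModel`.  ONE hypothesis-free structure (`ComplexRecordSystem`, the complex shadow of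
`UnitaryCanonicalModel.RecordSystem`), TWO definitions with bodies (`ComplexRecordSystem.record`, `RecordSystem.complexRecordSystem`)
and theorems.  No named fact; nothing asserted; T5: n/a.

* `ComplexRecordSystem L H τ T hT K₀` — the fields of `RecordSystem` ([Deligne1979ShimuraVarieties] 2.1.2–2.1.4, 2.2.5;
  [Milne2005ShimuraVarieties] Def. 12.10, Lemma 5.13) that only see the complex fibres: a functor `K ↦ Mc_K` on the small
  levels `K ≤ K₀` into `ℂ`-schemes, (C1) smooth projective, (C2a) `pts`, the transition clause `map_pts` («`[z, aK] ↦ [z, aK']`»,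
  2.1.4), (C2b) `hol`, (C2c) `pieces` — VERBATIM with `Mc_K` in place of `(M_K)_τ`; `RecordSystem.complexRecordSystem` is the
  shadow of a system.
* `ComplexRecord.exists_heckeComplex` — [Milne2005ShimuraVarieties] §13 p. 118 L25–26 («The map `T(g)` is a morphism of algebraic
  varieties over `ℂ`») for COMPLEX RECORDS: for `g⁻¹Kg ≤ K'` and complex records `C`, `C'` at `K`, `K'` there is a `ℂ`-morphism
  `C.Mc ⟶ C'.Mc` acting as `[z, aK] ↦ [z, agK']` — the proof of the tree's `RecordSystem.exists_heckeComplex` (gluing the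
  tree's Hecke translations of ball quotients `UnitaryBallHeckeTranslation.exists_hom_map_unif_mulVec_eq_of_nonempty`, Arapura
  Cor. 15.4.6 = `arapura2012_cor_15_4_6_holds`, along the `pieces` cofan) run on the `pieces` of `C`, `C'`.
* `ComplexRecord.hom_eq_of_forall_pts` — such morphisms are unique (`Mc` is smooth, hence reduced; `Mc'` projective, hence
  separated; the tree's `SchemeOver.hom_ext_of_forall_algPoints`).
* **`ComplexRecord.nonempty_complexRecordSystem`** — ONE complex record at every small level `K ≤ K₀` ASSEMBLES into a
  complex record system: the transition morphisms are the `g = 1` translates, functoriality by uniqueness.  With the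
  Summits-side `HComp.nonempty_complexRecord` (cell pub-hodgecm2) this inhabits `ComplexRecordSystem` at every datum of the
  named fact `exists_recordSystem`, WITHOUT any named fact: every clause of Deligne's `RecordSystem` except «the models live over
  `L`» and (F3) `recip` is then satisfied by construction.

HC_CM is not mentioned and not implied; no binder of any cell is discharged here.

## References
* [Deligne1979ShimuraVarieties] P. Deligne, *Variétés de Shimura* (1979), 2.1.2–2.1.4, 2.2.5 (Milne's translation
  `paper:url-7710442a1cf6`, PDF pp. 23–24 (2.1.2–2.1.4), 29 (2.2.5)).
* [Milne2005ShimuraVarieties] J. S. Milne, *Introduction to Shimura varieties* (2005/2017, `paper:url-b0e8e4ca1c12`), Lemma 5.13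
  p. 57, Def. 12.10 p. 115, §13 p. 118 L21–26, Prop. 13.1 p. 117.
* [Arapura2012] D. Arapura, *Algebraic Geometry over the Complex Numbers* (2012), Cor. 15.4.6.
-/

set_option autoImplicit false

noncomputable section

open Function MulAction Topology NumberField IsDedekindDomain CategoryTheory CategoryTheory.Limits Matrix
  AlgebraicGeometry
open scoped Matrix ComplexOrder
open Literature.AlgebraicGeometry.Motives
open Literature.NumberTheory.Automorphic Literature.NumberTheory.Automorphic.UnitaryGroup
open Literature.NumberTheory.Automorphic.Liu2021.AppendixC (C5.OpenCompactSubgroup C5.SmallLevel)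
open Literature.Geometry.ComplexHyperbolic Literature.Geometry.ComplexHyperbolic.BallModel
open Literature.NumberTheory.Automorphic.ShimuraDissection
open Literature.AlgebraicGeometry.HodgeTheory (HodgeModel)
open Literature.NumberTheory.Transcendental (arapura2012_cor_15_4_6_holds)

namespace Literature.AlgebraicGeometry.ShimuraVarieties

namespace UnitaryCanonicalModel

variable (L : Type) [Field L] [NumberField L] [IsCMField L] (H : Matrix (Fin 3) (Fin 3) L)
  (τ : L →+* ℂ) (T : GL (Fin 3) ℂ) (hT : formCongr (starRingEnd ℂ) T (H.map τ) = BallModel.J)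

/-! ### §1. The structure -/

/-- **The complex record system below `K₀`** — the complex shadow of `UnitaryCanonicalModel.RecordSystem L H τ T hT K₀`
([Deligne1979ShimuraVarieties] 2.1.2 «for `K` variable … the `_K M_ℂ` form a projective system», 2.1.4; [Milne2005ShimuraVarieties]
Def. 12.10 (a) «an inverse system of varieties», Lemma 5.13): a functor `K ↦ Mc_K` from the small levels `K ≤ K₀` (inclusions
only) to `ℂ`-schemes, with (C1) every `Mc_K` smooth of relative dimension `2` and projective, (C2a) `pts K : Mc_K(ℂ) ≃ₜ Sh_K(ℂ)`,
the transitions acting as `[z, aK] ↦ [z, aK']` on complex points, (C2b) `hol` and (C2c) `pieces` at every level — the fields of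
`RecordSystem` VERBATIM with `Mc_K` in place of `(M_K)_τ = M_K ⊗_{L,τ} ℂ`.  No model over `L`, no reciprocity.  Nothing is
asserted by the structure. [cite: Deligne1979ShimuraVarieties, 2.1.2–2.1.4 (PDF p. 24 of Milne's translation)]
[cite: Milne2005ShimuraVarieties, Def. 12.10 p. 115; Lemma 5.13 p. 57] -/
structure ComplexRecordSystem
    (K₀ : C5.OpenCompactSubgroup ↥(finAdelic (↥(maximalRealSubfield L)) L (IsCMField.complexConj L) 3 H)) where
  /-- the complex models `Mc_K`, `K ≤ K₀`, with their transition morphisms. -/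
  Mc : C5.SmallLevel K₀ ⥤ SchemeOver ℂ
  /-- (C1) every `Mc_K → Spec ℂ` is smooth of relative dimension `2`. -/
  smooth : ∀ K : C5.SmallLevel K₀, AlgebraicGeometry.SmoothOfRelativeDimension 2 (Mc.obj K).hom
  /-- (C1) every `Mc_K` is projective over `ℂ`. -/
  projective : ∀ K : C5.SmallLevel K₀, IsProjectiveOver (Mc.obj K)
  /-- (C2a) the complex points of `Mc_K` are `Sh_K(ℂ)`. -/
  pts : ∀ K : C5.SmallLevel K₀, ComplexPoints (Mc.obj K) ≃ₜ ShimuraSet L H τ T hT K.1.1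
  /-- the transition morphism `Mc_K → Mc_{K'}` (`K ≤ K'`) is `[z, aK] ↦ [z, aK']` on complex points. -/
  map_pts : ∀ (K K' : C5.SmallLevel K₀) (f : K ⟶ K') (z : Ball)
      (a : finAdelic (↥(maximalRealSubfield L)) L (IsCMField.complexConj L) 3 H),
      pts K' (AlgPoints.map (Mc.map f) ((pts K).symm (ShimuraSet.mk L H τ T hT K.1.1 z a))) =
        ShimuraSet.mk L H τ T hT K'.1.1 z a
  /-- (C2b) at every level, `z ↦ [z, aK]` is holomorphic in every algebraic coordinate of `Mc_K`. -/
  hol : ∀ (K : C5.SmallLevel K₀) (a : finAdelic (↥(maximalRealSubfield L)) L (IsCMField.complexConj L) 3 H),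
      ∃ u : (Fin 3 → ℂ) → ComplexPoints (Mc.obj K),
        (∀ x : Ball, u ((T : Matrix (Fin 3) (Fin 3) ℂ) *ᵥ BallModel.lift x) =
            (pts K).symm (ShimuraSet.mk L H τ T hT K.1.1 x a)) ∧
        (∀ v ∈ negCone (H.map τ), ∀ c : ℂ, c ≠ 0 → u (c • v) = u v) ∧
        ∀ (U : (Mc.obj K).left.affineOpens) (f : (Mc.obj K).left.presheaf.obj (Opposite.op (↑U : (Mc.obj K).left.Opens))),
          DifferentiableOn ℂ (fun v ↦ AlgPoints.evalOrZero (↑U : (Mc.obj K).left.Opens) f (u v))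
            (negCone (H.map τ) ∩ u ⁻¹' {P | P.pt ∈ (↑U : (Mc.obj K).left.Opens)})
  /-- (C2c) at every level, the pieces: a colimit cofan of compact ball quotients of the tree's kind by the natural levels. -/
  pieces : ∀ K : C5.SmallLevel K₀,
    ∃ (g : orbitRel.Quotient (rational (↥(maximalRealSubfield L)) L (IsCMField.complexConj L) 3 H)
          (CosetSpace (rationalToFinAdelic (↥(maximalRealSubfield L)) L (IsCMField.complexConj L) 3 H) K.1.1) →
        finAdelic (↥(maximalRealSubfield L)) L (IsCMField.complexConj L) 3 H)
      (_ : ∀ q, Quotient.mk'' (CosetSpace.pt (rationalToFinAdelic _ L _ 3 H) K.1.1 (g q)) = q)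
      (X : orbitRel.Quotient (rational (↥(maximalRealSubfield L)) L (IsCMField.complexConj L) 3 H)
          (CosetSpace (rationalToFinAdelic (↥(maximalRealSubfield L)) L (IsCMField.complexConj L) 3 H) K.1.1) →
        SchemeOver ℂ)
      (ι : ∀ q, X q ⟶ Mc.obj K)
      (_ : Limits.IsColimit (Limits.Cofan.mk (Mc.obj K) ι))
      (B : ∀ q, UnitaryBallUniformisationDatum 2 (X q)),
      ∀ q, (B q).Hℂ = H.map τ ∧
        (B q).Γ.map (Matrix.GeneralLinearGroup.map ((B q).τ₁ : ↥(B q).E →+* ℂ)) =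
          (arithmeticLevel (↥(maximalRealSubfield L)) L (IsCMField.complexConj L) 3 H
            (K.1.1.map (MulAut.conj (g q)).toMonoidHom)).map (Matrix.GeneralLinearGroup.map τ) ∧
        ∀ x : Ball, AlgPoints.map (ι q) ((B q).unif ((T : Matrix (Fin 3) (Fin 3) ℂ) *ᵥ BallModel.lift x)) =
          (pts K).symm (ShimuraSet.mk L H τ T hT K.1.1 x (g q))

variable {L H τ T hT}
variable {K₀ : C5.OpenCompactSubgroup ↥(finAdelic (↥(maximalRealSubfield L)) L (IsCMField.complexConj L) 3 H)}

/-- The complex record at ONE level `K ≤ K₀` of a complex record system. [cite: Deligne1979ShimuraVarieties, 2.1.2] -/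
def ComplexRecordSystem.record (S : ComplexRecordSystem L H τ T hT K₀) (K : C5.SmallLevel K₀) :
    ComplexRecord L H τ T hT K.1.1 where
  Mc := S.Mc.obj K
  smooth := S.smooth K
  projective := S.projective K
  pts := S.pts K
  hol := S.hol K
  pieces := S.pieces K

omit [NumberField L] [IsCMField L] in
/-- Naturality of `X_τ(ℂ) → X(ℂ)` (`AlgPoints.baseChangeEquiv`, inverse direction) in the `L`-scheme `X` (same statement
and proof as the tree's `HodgeTheory.baseChangeEquiv_symm_map`, here for arbitrary `L`-schemes). [folklore] -/
private theorem baseChangeEquiv_symm_map {X Y : SchemeOver L} (f : X ⟶ Y)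
    (u : ComplexPoints ((Motives.baseChangeHom τ).obj X)) :
    (letI : Algebra L ℂ := τ.toAlgebra
     (AlgPoints.baseChangeEquiv τ Y).symm (AlgPoints.map ((Motives.baseChangeHom τ).map f) u) =
      AlgPoints.map f ((AlgPoints.baseChangeEquiv τ X).symm u)) := by
  letI : Algebra L ℂ := τ.toAlgebra
  apply Over.OverMorphism.ext
  rw [AlgPoints.baseChangeEquiv_symm_apply_left, AlgPoints.map_apply, Over.comp_left,
    AlgPoints.map_apply, Over.comp_left, AlgPoints.baseChangeEquiv_symm_apply_left]
  simp only [Category.assoc, Motives.baseChangeHom_map_left_comp_fst]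
  exact (Category.assoc _ _ _).symm

/-- **The complex shadow of a record system**: `Mc := M ⋙ (· ⊗_{L,τ} ℂ)` (the functor `Motives.baseChangeHom τ`), every clause
moved as in `Record.complexRecord`; the transition clause by naturality of `AlgPoints.baseChangeEquiv`.
[cite: Deligne1979ShimuraVarieties, 2.1.2–2.1.4 and 2.2.5] -/
def RecordSystem.complexRecordSystem (S : RecordSystem L H τ T hT K₀) : ComplexRecordSystem L H τ T hT K₀ :=
  letI : Algebra L ℂ := τ.toAlgebra
  let b : ∀ K : C5.SmallLevel K₀, ComplexPoints (S.M.obj K) ≃ₜ ComplexPoints ((Motives.baseChangeHom τ).obj (S.M.obj K)) :=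
    fun K => Homeomorph.mk (AlgPoints.baseChangeEquiv τ (S.M.obj K)) (AlgPoints.continuous_baseChangeEquiv τ (S.M.obj K))
      (AlgPoints.continuous_baseChangeEquiv_symm τ (S.M.obj K))
  { Mc := S.M ⋙ Motives.baseChangeHom τ
    smooth := fun K => S.smooth_complexFibre K
    projective := fun K => S.projective_complexFibre K
    pts := fun K => (b K).symm.trans (S.pts K)
    map_pts := fun K K' f z a => by
      change S.pts K' ((AlgPoints.baseChangeEquiv τ (S.M.obj K')).symm
        (AlgPoints.map ((Motives.baseChangeHom τ).map (S.M.map f))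
          (AlgPoints.baseChangeEquiv τ (S.M.obj K) ((S.pts K).symm (ShimuraSet.mk L H τ T hT K.1.1 z a))))) = _
      rw [baseChangeEquiv_symm_map, Equiv.symm_apply_apply]
      exact S.map_pts K K' f z a
    hol := fun K => S.hol K
    pieces := fun K => S.pieces K }

/-- **Every record system has a complex shadow.** [cite: Deligne1979ShimuraVarieties, 2.1.2–2.1.4 and 2.2.5] -/
theorem RecordSystem.nonempty_complexRecordSystem (S : RecordSystem L H τ T hT K₀) :
    Nonempty (ComplexRecordSystem L H τ T hT K₀) :=
  ⟨S.complexRecordSystem⟩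

/-! ### §2. Morphisms between complex records are determined by their complex points -/

namespace ComplexRecord

variable {K K' K'' : Subgroup (finAdelic (↥(maximalRealSubfield L)) L (IsCMField.complexConj L) 3 H)}

/-- **Morphisms between the carriers of complex records are determined by their action on complex points** (`Mc` is smooth over
`ℂ`, hence reduced and locally of finite type; `Mc'` is projective, hence separated; the tree's
`SchemeOver.hom_ext_of_forall_algPoints`; [Milne2005ShimuraVarieties] Prop. 13.1 p. 117 «arises from a unique regular map»).
[cite: Milne2005ShimuraVarieties, Prop. 13.1 p. 117] -/
theorem hom_eq_of_forall_pts (C : ComplexRecord L H τ T hT K) (C' : ComplexRecord L H τ T hT K')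
    {f f' : C.Mc ⟶ C'.Mc} (h : ∀ x : ComplexPoints C.Mc, AlgPoints.map f x = AlgPoints.map f' x) : f = f' := by
  haveI := C.smooth
  haveI : Smooth C.Mc.hom := SmoothOfRelativeDimension.smooth 2 C.Mc.hom
  haveI : IsReduced C.Mc.left := isReduced_of_smooth_over_field C.Mc.hom
  haveI : IsProper C'.Mc.hom := C'.projective.isProper
  exact SchemeOver.hom_ext_of_forall_algPoints ℂ fun P => by simpa only [AlgPoints.map_apply] using h P

/-- Two morphisms of complex carriers acting as `[z, aK] ↦ [z, agK']` on complex points are equal.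
[cite: Milne2005ShimuraVarieties, Thm. 13.6 p. 118 and Prop. 13.1 p. 117] -/
theorem hecke_unique (C : ComplexRecord L H τ T hT K) (C' : ComplexRecord L H τ T hT K')
    {g : finAdelic (↥(maximalRealSubfield L)) L (IsCMField.complexConj L) 3 H} {Tg Tg' : C.Mc ⟶ C'.Mc}
    (h : ∀ (z : Ball) (a : finAdelic (↥(maximalRealSubfield L)) L (IsCMField.complexConj L) 3 H),
      AlgPoints.map Tg (C.pts.symm (ShimuraSet.mk L H τ T hT K z a)) = C'.pts.symm (ShimuraSet.mk L H τ T hT K' z (a * g)))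
    (h' : ∀ (z : Ball) (a : finAdelic (↥(maximalRealSubfield L)) L (IsCMField.complexConj L) 3 H),
      AlgPoints.map Tg' (C.pts.symm (ShimuraSet.mk L H τ T hT K z a)) = C'.pts.symm (ShimuraSet.mk L H τ T hT K' z (a * g))) :
    Tg = Tg' := by
  refine C.hom_eq_of_forall_pts C' fun x => ?_
  obtain ⟨⟨z, a⟩, hx⟩ := ShimuraSet.mk_surjective L H τ T hT K (C.pts x)
  have hx' : x = C.pts.symm (ShimuraSet.mk L H τ T hT K z a) := by
    rw [← Homeomorph.symm_apply_apply C.pts x, ← hx]; rfl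
  subst hx'
  rw [h z a, h' z a]

/-! ### §3. [Milne 2005] §13 p. 118 L25–26 for complex records: the Hecke translate is a morphism over `ℂ` -/

set_option maxHeartbeats 1600000 in -- large adelic / Shimura-set terms: instance-heavy statement (as the record version)
/-- **The Hecke translate `[z, aK] ↦ [z, agK']` between complex records is a morphism over `ℂ`** ([Milne2005ShimuraVarieties] §13
p. 118 L25–26 «The map `T(g)` is a morphism of algebraic varieties over `ℂ`»): for `g⁻¹Kg ≤ K'` and complex records `C` at `K`,
`C'` at `K'`, there is `Tc : C.Mc ⟶ C'.Mc` with `Tc (pts⁻¹ [z, aK]) = pts'⁻¹ [z, agK']`.  The proof of the tree's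
`RecordSystem.exists_heckeComplex` verbatim on the `pieces` of `C`, `C'`: piece by piece the tree's Hecke translation of ball
quotients (`UnitaryBallHeckeTranslation.exists_hom_map_unif_mulVec_eq_of_nonempty`, Arapura Cor. 15.4.6 =
`arapura2012_cor_15_4_6_holds`), glued by `Cofan.IsColimit.desc`. [cite: Milne2005ShimuraVarieties, §13 p. 118 L21–26; Lemma 5.13 p. 57]
[cite: Deligne1979ShimuraVarieties, 2.1.2–2.1.4] [cite: Arapura2012, §15.4 Cor. 15.4.6] -/
theorem exists_heckeComplex (C : ComplexRecord L H τ T hT K) (C' : ComplexRecord L H τ T hT K')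
    (g : finAdelic (↥(maximalRealSubfield L)) L (IsCMField.complexConj L) 3 H) (hK : ∀ k ∈ K, g⁻¹ * k * g ∈ K') :
    ∃ Tc : C.Mc ⟶ C'.Mc, ∀ (z : Ball) (a : finAdelic (↥(maximalRealSubfield L)) L (IsCMField.complexConj L) 3 H),
      AlgPoints.map Tc (C.pts.symm (ShimuraSet.mk L H τ T hT K z a)) = C'.pts.symm (ShimuraSet.mk L H τ T hT K' z (a * g)) := by
  classical
  obtain ⟨gq, hgq, X, ι, hcol, B, hB⟩ := C.pieces
  obtain ⟨gq', hgq', X', ι', hcol', B', hB'⟩ := C'.pieces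
  -- for each piece `q`: the target class `q'` and a rational `γ_q` with `(φ(γ_q) g_q g)⁻¹ g'_{q'} ∈ K'`
  let q' : orbitRel.Quotient (rational (↥(maximalRealSubfield L)) L (IsCMField.complexConj L) 3 H)
      (CosetSpace (rationalToFinAdelic (↥(maximalRealSubfield L)) L (IsCMField.complexConj L) 3 H) K) →
      orbitRel.Quotient (rational (↥(maximalRealSubfield L)) L (IsCMField.complexConj L) 3 H)
      (CosetSpace (rationalToFinAdelic (↥(maximalRealSubfield L)) L (IsCMField.complexConj L) 3 H) K') :=
    fun q => Quotient.mk'' (CosetSpace.pt (rationalToFinAdelic (↥(maximalRealSubfield L)) L (IsCMField.complexConj L) 3 H) K' (gq q * g))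
  have hrep : ∀ q, ∃ γ : rational (↥(maximalRealSubfield L)) L (IsCMField.complexConj L) 3 H,
      (rationalToFinAdelic (↥(maximalRealSubfield L)) L (IsCMField.complexConj L) 3 H γ * (gq q * g))⁻¹ * gq' (q' q) ∈ K' :=
    fun q => exists_rational_rep hgq' (gq q * g)
  choose γ hγ using hrep
  -- Hodge models of the pieces and Arapura's theorem
  have hHM : ∀ q, Nonempty (HodgeModel 2 (X q)) := fun q =>
    let ⟨A, _⟩ := HodgeTheory.exists_isReal_hodgeModel_holds 2 (X q) (B q).isSmoothProjective; ⟨A⟩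
  have hHM' : ∀ q, Nonempty (HodgeModel 2 (X' q)) := fun q =>
    let ⟨A, _⟩ := HodgeTheory.exists_isReal_hodgeModel_holds 2 (X' q) (B' q).isSmoothProjective; ⟨A⟩
  -- the piece morphisms `X_q ⟶ X'_{q'}`, `[v] ↦ [γ_q^τ v]`
  have hpiece : ∀ q, ∃ f : X q ⟶ X' (q' q), ∀ v ∈ (B q).cone, AlgPoints.map f ((B q).unif v) =
      (B' (q' q)).unif (((Matrix.GeneralLinearGroup.map τ ((γ q : rational _ L _ 3 H) : GL (Fin 3) L) :
        GL (Fin 3) ℂ) : Matrix (Fin 3) (Fin 3) ℂ) *ᵥ v) := by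
    intro q
    obtain ⟨hH1, hΓ1, -⟩ := hB q
    obtain ⟨hH2, hΓ2, -⟩ := hB' (q' q)
    refine UnitaryBallHeckeTranslation.exists_hom_map_unif_mulVec_eq_of_nonempty arapura2012_cor_15_4_6_holds
      (hHM q) (hHM' (q' q)) ?_ ?_
    · rw [hH1, hH2]
      exact conjTranspose_map_mul_map (τ := τ) (γ q)
    · rw [hΓ1, hΓ2, Subgroup.map_map]
      have hcomm : ((MulAut.conj (Matrix.GeneralLinearGroup.map τ ((γ q : rational _ L _ 3 H) : GL (Fin 3) L))).toMonoidHom).comp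
          (Matrix.GeneralLinearGroup.map τ) =
        (Matrix.GeneralLinearGroup.map (n := Fin 3) τ).comp
          (MulAut.conj ((γ q : rational _ L _ 3 H) : GL (Fin 3) L)).toMonoidHom := by
        ext δ i j
        simp [MulAut.conj_apply, map_mul, map_inv]
      rw [hcomm, ← Subgroup.map_map]
      apply Subgroup.map_mono
      have hγq := hγ q
      rw [← mul_assoc] at hγq
      exact conj_arithmeticLevel_le (K := K) (K' := K') hK hγq
  choose f hf using hpiece
  -- glue along the coproduct
  refine ⟨Cofan.IsColimit.desc hcol fun q => f q ≫ ι' (q' q), fun z a => ?_⟩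
  obtain ⟨δ, hδ⟩ := exists_rational_rep hgq a
  set q : orbitRel.Quotient (rational (↥(maximalRealSubfield L)) L (IsCMField.complexConj L) 3 H)
      (CosetSpace (rationalToFinAdelic (↥(maximalRealSubfield L)) L (IsCMField.complexConj L) 3 H) K) :=
    Quotient.mk'' (CosetSpace.pt (rationalToFinAdelic (↥(maximalRealSubfield L)) L (IsCMField.complexConj L) 3 H) K a)
    with hqdef
  set x : Ball := ratToU21 L H τ T hT δ • z with hx
  have hza : ShimuraSet.mk L H τ T hT K z a = ShimuraSet.mk L H τ T hT K x (gq q) := by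
    refine (ShimuraSet.mk_eq_mk_iff L H τ T hT K _ _ _ _).mpr ⟨δ⁻¹, ?_, ?_⟩
    · rw [hx, smul_smul, ← map_mul, inv_mul_cancel, map_one, one_smul]
    · simpa only [map_inv, _root_.mul_inv_rev, mul_assoc] using hδ
  have hza' : ShimuraSet.mk L H τ T hT K' z (a * g) = ShimuraSet.mk L H τ T hT K' x (gq q * g) := by
    refine (ShimuraSet.mk_eq_mk_iff L H τ T hT K' _ _ _ _).mpr ⟨δ⁻¹, ?_, ?_⟩
    · rw [hx, smul_smul, ← map_mul, inv_mul_cancel, map_one, one_smul]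
    · have h := hK _ hδ
      simpa only [map_inv, _root_.mul_inv_rev, mul_assoc, inv_inv] using h
  have hxq : ShimuraSet.mk L H τ T hT K' x (gq q * g) =
      ShimuraSet.mk L H τ T hT K' (ratToU21 L H τ T hT (γ q) • x) (gq' (q' q)) := by
    refine (ShimuraSet.mk_eq_mk_iff L H τ T hT K' _ _ _ _).mpr ⟨(γ q)⁻¹, ?_, ?_⟩
    · rw [smul_smul, ← map_mul, inv_mul_cancel, map_one, one_smul]
    · have h := hγ q
      simpa only [map_inv, _root_.mul_inv_rev, mul_assoc, inv_inv] using h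
  rw [hza, hza', hxq]
  have hcone : (T : Matrix (Fin 3) (Fin 3) ℂ) *ᵥ BallModel.lift x ∈ (B q).cone := by
    change _ ∈ negCone (B q).Hℂ
    rw [(hB q).1]
    exact frame_mulVec_lift_mem_negCone hT x
  have hcone' : (T : Matrix (Fin 3) (Fin 3) ℂ) *ᵥ BallModel.lift (ratToU21 L H τ T hT (γ q) • x) ∈ (B' (q' q)).cone := by
    change _ ∈ negCone (B' (q' q)).Hℂ
    rw [(hB' (q' q)).1]
    exact frame_mulVec_lift_mem_negCone hT _
  obtain ⟨c, hc, hcx⟩ := mulVec_frame_lift_ratToU21_smul (hT := hT) (γ q) x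
  rw [← (hB q).2.2 x, ← (hB' (q' q)).2.2, ← AlgPoints.map_comp_apply]
  change AlgPoints.map ((Cofan.mk _ ι).inj q ≫ Cofan.IsColimit.desc hcol fun q => f q ≫ ι' (q' q)) _ = _
  rw [Cofan.IsColimit.fac, AlgPoints.map_comp_apply, hf q _ hcone, hcx, (B' (q' q)).unif_smul hc hcone']

/-- **The transition morphism** (`g = 1`, `K ≤ K'`): a `ℂ`-morphism `C.Mc ⟶ C'.Mc` acting as `[z, aK] ↦ [z, aK']`
([Deligne1979ShimuraVarieties] 2.1.4). [cite: Deligne1979ShimuraVarieties, 2.1.4] [cite: Milne2005ShimuraVarieties, §5 p. 58 L3–6] -/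
theorem exists_transition (C : ComplexRecord L H τ T hT K) (C' : ComplexRecord L H τ T hT K') (hKK' : K ≤ K') :
    ∃ Tc : C.Mc ⟶ C'.Mc, ∀ (z : Ball) (a : finAdelic (↥(maximalRealSubfield L)) L (IsCMField.complexConj L) 3 H),
      AlgPoints.map Tc (C.pts.symm (ShimuraSet.mk L H τ T hT K z a)) = C'.pts.symm (ShimuraSet.mk L H τ T hT K' z a) := by
  obtain ⟨Tc, hTc⟩ := C.exists_heckeComplex C' 1 (fun k hk => by simpa only [inv_one, one_mul, mul_one] using hKK' hk)
  exact ⟨Tc, fun z a => by rw [hTc z a, mul_one]⟩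

end ComplexRecord

/-! ### §4. One complex record per small level assembles into a complex record system -/

/-- **Complex records at every small level assemble into a complex record SYSTEM**: given a complex record `C K` at every
`K ≤ K₀`, the transitions `[z, aK] ↦ [z, aK']` (`ComplexRecord.exists_transition`) are unique (`ComplexRecord.hecke_unique`),
hence functorial, and the per-level clauses are those of the `C K` ([Deligne1979ShimuraVarieties] 2.1.2–2.1.4: the `_K M_ℂ` form
a projective system).  [cite: Deligne1979ShimuraVarieties, 2.1.2–2.1.4] [cite: Milne2005ShimuraVarieties, Def. 12.10 p. 115] -/
theorem ComplexRecord.nonempty_complexRecordSystem (C : ∀ K : C5.SmallLevel K₀, ComplexRecord L H τ T hT K.1.1) :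
    ∃ S : ComplexRecordSystem L H τ T hT K₀, ∀ K, S.Mc.obj K = (C K).Mc ∧ HEq (S.pts K) (C K).pts := by
  classical
  -- the transition morphisms, chosen
  have htr : ∀ K K' : C5.SmallLevel K₀, K ≤ K' → ∃ Tc : (C K).Mc ⟶ (C K').Mc,
      ∀ (z : Ball) (a : finAdelic (↥(maximalRealSubfield L)) L (IsCMField.complexConj L) 3 H),
        AlgPoints.map Tc ((C K).pts.symm (ShimuraSet.mk L H τ T hT K.1.1 z a)) =
          (C K').pts.symm (ShimuraSet.mk L H τ T hT K'.1.1 z a) :=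
    fun K K' h => (C K).exists_transition (C K') h
  choose tr htr using htr
  have huniq : ∀ (K K' : C5.SmallLevel K₀) (h : K ≤ K') (f : (C K).Mc ⟶ (C K').Mc),
      (∀ (z : Ball) (a : finAdelic (↥(maximalRealSubfield L)) L (IsCMField.complexConj L) 3 H),
        AlgPoints.map f ((C K).pts.symm (ShimuraSet.mk L H τ T hT K.1.1 z a)) =
          (C K').pts.symm (ShimuraSet.mk L H τ T hT K'.1.1 z a)) → f = tr K K' h := by
    intro K K' h f hf
    refine (C K).hecke_unique (C K') (g := 1) (fun z a => ?_) (fun z a => ?_)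
    · rw [hf z a, mul_one]
    · rw [htr K K' h z a, mul_one]
  let Mc : C5.SmallLevel K₀ ⥤ SchemeOver ℂ :=
    { obj := fun K => (C K).Mc
      map := fun {K K'} f => tr K K' (leOfHom f)
      map_id := fun K => by
        symm
        refine huniq K K le_rfl (𝟙 _) fun z a => ?_
        rw [AlgPoints.map_id]
        rfl
      map_comp := fun {K K' K''} f f' => by
        symm
        refine huniq K K'' (leOfHom (f ≫ f')) _ fun z a => ?_
        rw [AlgPoints.map_comp_apply, htr K K' (leOfHom f) z a, htr K' K'' (leOfHom f') z a] }
  refine ⟨{ Mc := Mc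
            smooth := fun K => (C K).smooth
            projective := fun K => (C K).projective
            pts := fun K => (C K).pts
            map_pts := fun K K' f z a => ?_
            hol := fun K => (C K).hol
            pieces := fun K => (C K).pieces }, fun K => ⟨rfl, HEq.rfl⟩⟩
  change (C K').pts (AlgPoints.map (tr K K' (leOfHom f)) ((C K).pts.symm (ShimuraSet.mk L H τ T hT K.1.1 z a))) = _
  rw [htr K K' (leOfHom f) z a, Homeomorph.apply_symm_apply]

/-! ### §5. The complex record is unique up to a unique isomorphism -/

/-- **Uniqueness of the complex model** ([Deligne1979ShimuraVarieties] 2.1.2 «it follows from [3] that this structure is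
unique» (Borel), PDF p. 24 L14–16 of Milne's translation; [Milne2005ShimuraVarieties] Thm. 3.14 (Borel 1972) p. 39 and Cor. 3.16
p. 40 «The structure of an algebraic variety on `D(Γ)` is unique»): two complex records at the same level have ISOMORPHIC
carriers, by a `ℂ`-isomorphism respecting `pts` (the transitions `[z, aK] ↦ [z, aK]` in both directions,
`ComplexRecord.exists_transition`, compose to morphisms acting as the identity on complex points, hence equal to the identity,
`ComplexRecord.hom_eq_of_forall_pts`). [cite: Deligne1979ShimuraVarieties, 2.1.2 (PDF p. 24 L14–16 of Milne's translation)]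
[cite: Milne2005ShimuraVarieties, Thm. 3.14 p. 39 and Cor. 3.16 p. 40] -/
theorem ComplexRecord.nonempty_iso {K : Subgroup (finAdelic (↥(maximalRealSubfield L)) L (IsCMField.complexConj L) 3 H)}
    (C C' : ComplexRecord L H τ T hT K) :
    ∃ e : C.Mc ≅ C'.Mc, ∀ x : ComplexPoints C.Mc, C'.pts (AlgPoints.map e.hom x) = C.pts x := by
  obtain ⟨f, hf⟩ := C.exists_transition C' le_rfl
  obtain ⟨g, hg⟩ := C'.exists_transition C le_rfl
  have hpt : ∀ (D : ComplexRecord L H τ T hT K) (x : ComplexPoints D.Mc),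
      ∃ (z : Ball) (a : finAdelic (↥(maximalRealSubfield L)) L (IsCMField.complexConj L) 3 H),
        x = D.pts.symm (ShimuraSet.mk L H τ T hT K z a) := by
    intro D x
    obtain ⟨⟨z, a⟩, hx⟩ := ShimuraSet.mk_surjective L H τ T hT K (D.pts x)
    exact ⟨z, a, by rw [← Homeomorph.symm_apply_apply D.pts x, ← hx]; rfl⟩
  have hfg : f ≫ g = 𝟙 _ := C.hom_eq_of_forall_pts C fun x => by
    obtain ⟨z, a, rfl⟩ := hpt C x
    rw [AlgPoints.map_comp_apply, hf, hg, AlgPoints.map_id]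
    rfl
  have hgf : g ≫ f = 𝟙 _ := C'.hom_eq_of_forall_pts C' fun x => by
    obtain ⟨z, a, rfl⟩ := hpt C' x
    rw [AlgPoints.map_comp_apply, hg, hf, AlgPoints.map_id]
    rfl
  refine ⟨⟨f, g, hfg, hgf⟩, fun x => ?_⟩
  obtain ⟨z, a, rfl⟩ := hpt C x
  change C'.pts (AlgPoints.map f _) = _
  rw [hf, Homeomorph.apply_symm_apply, Homeomorph.apply_symm_apply]

end UnitaryCanonicalModel

end Literature.AlgebraicGeometry.ShimuraVarieties

end
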